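import Summits.AtomisticToContinuum.HydrodynamicLimit.Theorems.ImplosionDichotomyPolynomialCompressionLevel3Defs
import Summits.AtomisticToContinuum.HydrodynamicLimit.Theorems.ImplosionDichotomyPolynomialCompressionLevel2Forcing
import Summits.AtomisticToContinuum.HydrodynamicLimit.Theorems.ImplosionDichotomyPolynomialCompressionSubTopBounds

/-!
# Level-3 forcing minus its top-order part: crude pointwise bound, velocity component

Helper file for the line `log-lipschitz-budget` of the crux `ImplosionDichotomy.PolynomialCompression`
(stmt-AtomisticToContinuum-12587), stub `stub_logBudgetShadowing` (level-3 estimate, crude part). Velocity analogue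
of `level3_crude_density` for `l3Fu - l3Topu` (ideal-gas reference: `hsPressure 0 r θ = r θ`, law `ζ₂ ≡ 1`); the
pressure-coefficient difference is split WITHOUT difference calculus,
`θγ(ρ)/ρ - θ₁/ρ₁ = δθ·γ(ρ)/ρ + θ₁(γ(ρ) - 1)/ρ - δρ·θ₁/(ρρ₁)` (`γ = ζ + ρζ'`), the middle term and `(ζ(ρ) - 1)∂θ₁`
being the equation-of-state forcing with the small envelope `Z` of `Level3Coeff`.

Structure: the level-3 identity is one commutator step (`hsEuler_frozen_commutator_velocity`) on the level-2
forcing (`hsEuler_level2_forcing_velocity`, reference law `ζ₂ ≡ 1`), unfolded by linearity of iterated partial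
derivatives; the estimate itself is the abstract `l3cv_core` (Leibniz remainders `abs_partialDeriv_mul_sub_top_le(')`
for every product, `HasDerivBoundsAt₃.three` for the equation-of-state forcing, then bookkeeping of the constants).
-/

noncomputable section

namespace Summit.AtomisticToContinuum.HydrodynamicLimit.Theorems

open Set MeasureTheory
open Literature.MathematicalPhysics.KineticTheory Literature.Analysis.FunctionSpaces

/-! ### Private helpers: smoothness closure and linearity of `Torus.partialDeriv` in applied form -/

/-- Sums of smooth real functions on `𝕋³` are smooth (applied form). [folklore] -/
private theorem l3cv_sm_add {F G : T3 → ℝ} (hF : Torus.IsSmooth F) (hG : Torus.IsSmooth G) :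
    Torus.IsSmooth (fun y => F y + G y) := hF.add hG

/-- Differences of smooth real functions on `𝕋³` are smooth (applied form). [folklore] -/
private theorem l3cv_sm_sub {F G : T3 → ℝ} (hF : Torus.IsSmooth F) (hG : Torus.IsSmooth G) :
    Torus.IsSmooth (fun y => F y - G y) := hF.sub hG

/-- Negatives of smooth real functions on `𝕋³` are smooth (applied form). [folklore] -/
private theorem l3cv_sm_neg {F : T3 → ℝ} (hF : Torus.IsSmooth F) : Torus.IsSmooth (fun y => -F y) := hF.neg

/-- Products of smooth real functions on `𝕋³` are smooth (applied form). [folklore] -/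
private theorem l3cv_sm_mul {F G : T3 → ℝ} (hF : Torus.IsSmooth F) (hG : Torus.IsSmooth G) :
    Torus.IsSmooth (fun y => F y * G y) := ContDiff.mul hF hG

/-- Quotients of smooth real functions on `𝕋³` by nowhere-vanishing ones are smooth. [folklore] -/
private theorem l3cv_sm_div {F G : T3 → ℝ} (hF : Torus.IsSmooth F) (hG : Torus.IsSmooth G)
    (h0 : ∀ y, G y ≠ 0) : Torus.IsSmooth (fun y => F y / G y) := ContDiff.div hF hG fun _ => h0 _

/-- Finite sums (over `Fin 3`) of smooth real functions on `𝕋³` are smooth (applied form). [folklore] -/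
private theorem l3cv_sm_sum {F : Fin 3 → T3 → ℝ} (hF : ∀ i, Torus.IsSmooth (F i)) :
    Torus.IsSmooth (fun y => ∑ i, F i y) := by
  have hl : Torus.lift (fun y => ∑ i, F i y) = fun z => ∑ i, Torus.lift (F i) z := rfl
  unfold Torus.IsSmooth
  rw [hl]
  exact ContDiff.sum fun i _ => hF i

/-- `∂ₖ(F + G) = ∂ₖF + ∂ₖG` as functions (applied form). [folklore] -/
private theorem l3cv_pd_add {F G : T3 → ℝ} (hF : Torus.IsSmooth F) (hG : Torus.IsSmooth G) (k : Fin 3) :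
    Torus.partialDeriv k (fun y => F y + G y) = fun y => Torus.partialDeriv k F y + Torus.partialDeriv k G y :=
  Torus.partialDeriv_add (hF.isContDiff (by simp)) (hG.isContDiff (by simp)) k

/-- `∂ₖ(-F) = -∂ₖF` as functions (applied form). [folklore] -/
private theorem l3cv_pd_neg {F : T3 → ℝ} (hF : Torus.IsSmooth F) (k : Fin 3) :
    Torus.partialDeriv k (fun y => -F y) = fun y => -Torus.partialDeriv k F y := by
  have e : (fun y => -F y) = fun y => (-1 : ℝ) * F y := by funext y; ring
  rw [e, Torus.partialDeriv_const_mul_fun (hF.isContDiff (by simp)) (-1) k]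
  funext y; ring

/-- `∂ₖ(F - G) = ∂ₖF - ∂ₖG` as functions (applied form). [folklore] -/
private theorem l3cv_pd_sub {F G : T3 → ℝ} (hF : Torus.IsSmooth F) (hG : Torus.IsSmooth G) (k : Fin 3) :
    Torus.partialDeriv k (fun y => F y - G y) = fun y => Torus.partialDeriv k F y - Torus.partialDeriv k G y := by
  have e : (fun y => F y - G y) = fun y => F y + -G y := by funext y; ring
  rw [e, l3cv_pd_add hF (l3cv_sm_neg hG) k, l3cv_pd_neg hG k]
  funext y; ring

/-- `∂ₖ(Σᵢ Fᵢ) = Σᵢ ∂ₖFᵢ` (sum over `Fin 3`) as functions (applied form). [folklore] -/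
private theorem l3cv_pd_sum {F : Fin 3 → T3 → ℝ} (hF : ∀ i, Torus.IsSmooth (F i)) (k : Fin 3) :
    Torus.partialDeriv k (fun y => ∑ i, F i y) = fun y => ∑ i, Torus.partialDeriv k (F i) y :=
  funext fun y => Torus.partialDeriv_finset_sum Finset.univ (fun i _ => (hF i).isContDiff (by simp)) k y

/-- Smoothness of, and linearity of `∂ₖ` on, the shape `-(Σᵢ Fᵢ) - P + R - E` of the split velocity
forcing. [folklore] -/
private theorem l3cv_shapeA {F : Fin 3 → T3 → ℝ} {P R E : T3 → ℝ} (hF : ∀ i, Torus.IsSmooth (F i))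
    (hP : Torus.IsSmooth P) (hR : Torus.IsSmooth R) (hE : Torus.IsSmooth E) (k : Fin 3) :
    Torus.IsSmooth (fun y => -(∑ i, F i y) - P y + R y - E y) ∧
    Torus.partialDeriv k (fun y => -(∑ i, F i y) - P y + R y - E y) =
      fun y => -(∑ i, Torus.partialDeriv k (F i) y) - Torus.partialDeriv k P y +
        Torus.partialDeriv k R y - Torus.partialDeriv k E y := by
  have hS := l3cv_sm_sum hF
  have h1 := l3cv_sm_sub (l3cv_sm_neg hS) hP
  refine ⟨l3cv_sm_sub (l3cv_sm_add h1 hR) hE, ?_⟩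
  rw [l3cv_pd_sub (l3cv_sm_add h1 hR) hE k, l3cv_pd_add h1 hR k, l3cv_pd_sub (l3cv_sm_neg hS) hP k,
    l3cv_pd_neg hS k, l3cv_pd_sum hF k]

/-- Smoothness of, and linearity of `∂ₖ` on, the shape `Σᵢ Fᵢ + P + R` of the commutators. [folklore] -/
private theorem l3cv_shapeB {F : Fin 3 → T3 → ℝ} {P R : T3 → ℝ} (hF : ∀ i, Torus.IsSmooth (F i))
    (hP : Torus.IsSmooth P) (hR : Torus.IsSmooth R) (k : Fin 3) :
    Torus.IsSmooth (fun y => ∑ i, F i y + P y + R y) ∧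
    Torus.partialDeriv k (fun y => ∑ i, F i y + P y + R y) =
      fun y => ∑ i, Torus.partialDeriv k (F i) y + Torus.partialDeriv k P y + Torus.partialDeriv k R y := by
  have hS := l3cv_sm_sum hF
  refine ⟨l3cv_sm_add (l3cv_sm_add hS hP) hR, ?_⟩
  rw [l3cv_pd_add (l3cv_sm_add hS hP) hR k, l3cv_pd_add hS hP k, l3cv_pd_sum hF k]

/-- Third derivatives of the split forcing shape, term by term. [folklore] -/
private theorem l3cv_lin3 {F : Fin 3 → T3 → ℝ} {P R E : T3 → ℝ} (hF : ∀ i, Torus.IsSmooth (F i))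
    (hP : Torus.IsSmooth P) (hR : Torus.IsSmooth R) (hE : Torus.IsSmooth E) (l m n : Fin 3) (x : T3) :
    Torus.partialDeriv n (Torus.partialDeriv m (Torus.partialDeriv l
        (fun y => -(∑ i, F i y) - P y + R y - E y))) x =
      -(∑ i, Torus.partialDeriv n (Torus.partialDeriv m (Torus.partialDeriv l (F i))) x) -
        Torus.partialDeriv n (Torus.partialDeriv m (Torus.partialDeriv l P)) x +
        Torus.partialDeriv n (Torus.partialDeriv m (Torus.partialDeriv l R)) x -
        Torus.partialDeriv n (Torus.partialDeriv m (Torus.partialDeriv l E)) x := by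
  rw [(l3cv_shapeA hF hP hR hE l).2, (l3cv_shapeA (fun i => (hF i).partialDeriv l) (hP.partialDeriv l)
      (hR.partialDeriv l) (hE.partialDeriv l) m).2,
    (l3cv_shapeA (fun i => ((hF i).partialDeriv l).partialDeriv m) ((hP.partialDeriv l).partialDeriv m)
      ((hR.partialDeriv l).partialDeriv m) ((hE.partialDeriv l).partialDeriv m) n).2]

/-- Second derivatives of the commutator shape, term by term. [folklore] -/
private theorem l3cv_lin2 {F : Fin 3 → T3 → ℝ} {P R : T3 → ℝ} (hF : ∀ i, Torus.IsSmooth (F i))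
    (hP : Torus.IsSmooth P) (hR : Torus.IsSmooth R) (m n : Fin 3) (x : T3) :
    Torus.partialDeriv n (Torus.partialDeriv m (fun y => ∑ i, F i y + P y + R y)) x =
      ∑ i, Torus.partialDeriv n (Torus.partialDeriv m (F i)) x +
        Torus.partialDeriv n (Torus.partialDeriv m P) x + Torus.partialDeriv n (Torus.partialDeriv m R) x := by
  rw [(l3cv_shapeB hF hP hR m).2,
    (l3cv_shapeB (fun i => (hF i).partialDeriv m) (hP.partialDeriv m) (hR.partialDeriv m) n).2]

/-- Unfolding the nested level-3 expression `∂ₙ(∂ₘ(∂ₗF - C_l) - C_m)` by linearity. [folklore] -/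
private theorem l3cv_expand {F Cl Cm : T3 → ℝ} (hF : Torus.IsSmooth F) (hCl : Torus.IsSmooth Cl)
    (hCm : Torus.IsSmooth Cm) (l m n : Fin 3) (x : T3) :
    Torus.partialDeriv n (fun y₂ => Torus.partialDeriv m
        (fun y₁ => Torus.partialDeriv l F y₁ - Cl y₁) y₂ - Cm y₂) x =
      Torus.partialDeriv n (Torus.partialDeriv m (Torus.partialDeriv l F)) x -
        Torus.partialDeriv n (Torus.partialDeriv m Cl) x - Torus.partialDeriv n Cm x := by
  simp only [l3cv_pd_sub (hF.partialDeriv l) hCl m]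
  rw [l3cv_pd_sub (l3cv_sm_sub ((hF.partialDeriv l).partialDeriv m) (hCl.partialDeriv m)) hCm n]
  simp only [l3cv_pd_sub ((hF.partialDeriv l).partialDeriv m) (hCl.partialDeriv m) n]

/-! ### The bound with the calculus done (abstract coefficient and difference functions) -/

/-- **Crude level-3 bound, abstract form.** For smooth `δuᵢ, δρ, δθ` (jets `≤ d₀, d₁, d₂` at `x`),
coefficients `ucᵢ` (derivatives of orders `1–3` bounded by `M, M(1+S₂), M(1+S₂+S₃)`), and
`A, ζf, du1ᵢ, G1, G2` resp. `E1` with `HasDerivBoundsAt₃ · x M S₂ S₃` resp. `Z`: the expanded level-3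
expression minus its top-order part is at most `l3Rem` (atoms: `abs_partialDeriv_mul_sub_top_le(')`).
[folklore] -/
private theorem l3cv_core {x : T3} {l m n j : Fin 3} {M Z S₂ S₃ d₀ d₁ d₂ Cn : ℝ}
    {δu uc du1 : Fin 3 → T3 → ℝ} {δρ δθ A ζf G1 G2 E1 : T3 → ℝ}
    (hS₂ : 0 ≤ S₂) (hS₃ : 0 ≤ S₃) (hd₀ : 0 ≤ d₀) (hd₁ : 0 ≤ d₁) (hd₂ : 0 ≤ d₂)
    (sδu : ∀ i, Torus.IsSmooth (δu i)) (suc : ∀ i, Torus.IsSmooth (uc i)) (sdu1 : ∀ i, Torus.IsSmooth (du1 i))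
    (sδρ : Torus.IsSmooth δρ) (sδθ : Torus.IsSmooth δθ) (sA : Torus.IsSmooth A) (sζ : Torus.IsSmooth ζf)
    (sG1 : Torus.IsSmooth G1) (sG2 : Torus.IsSmooth G2) (sE1 : Torus.IsSmooth E1)
    (huc1 : ∀ i a, |Torus.partialDeriv a (uc i) x| ≤ M)
    (huc2 : ∀ i a b, |Torus.partialDeriv b (Torus.partialDeriv a (uc i)) x| ≤ M * (1 + S₂))
    (huc3 : ∀ i a b c,
      |Torus.partialDeriv c (Torus.partialDeriv b (Torus.partialDeriv a (uc i))) x| ≤ M * (1 + S₂ + S₃))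
    (hA : Torus.HasDerivBoundsAt₃ A x M S₂ S₃) (hζ : Torus.HasDerivBoundsAt₃ ζf x M S₂ S₃)
    (hdu1 : ∀ i, Torus.HasDerivBoundsAt₃ (du1 i) x M S₂ S₃) (hG1 : Torus.HasDerivBoundsAt₃ G1 x M S₂ S₃)
    (hG2 : Torus.HasDerivBoundsAt₃ G2 x M S₂ S₃) (hE1 : Torus.HasDerivBoundsAt₃ E1 x Z S₂ S₃)
    (j0u : ∀ i, |δu i x| ≤ d₀) (j1u : ∀ i a, |Torus.partialDeriv a (δu i) x| ≤ d₁)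
    (j2u : ∀ i a b, |Torus.partialDeriv b (Torus.partialDeriv a (δu i)) x| ≤ d₂)
    (j0ρ : |δρ x| ≤ d₀) (j1ρ : ∀ a, |Torus.partialDeriv a δρ x| ≤ d₁)
    (j2ρ : ∀ a b, |Torus.partialDeriv b (Torus.partialDeriv a δρ) x| ≤ d₂)
    (j0θ : |δθ x| ≤ d₀) (j1θ : ∀ a, |Torus.partialDeriv a δθ x| ≤ d₁)
    (j2θ : ∀ a b, |Torus.partialDeriv b (Torus.partialDeriv a δθ) x| ≤ d₂) :
    |Torus.partialDeriv n (Torus.partialDeriv m (Torus.partialDeriv l (fun y =>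
          -(∑ i, δu i y * du1 i y) - δθ y * G1 y + δρ y * G2 y - E1 y))) x -
        Torus.partialDeriv n (Torus.partialDeriv m (fun y =>
          ∑ i, Torus.partialDeriv l (uc i) y * Torus.partialDeriv i (δu j) y +
            Torus.partialDeriv l A y * Torus.partialDeriv j δρ y +
            Torus.partialDeriv l ζf y * Torus.partialDeriv j δθ y)) x -
        Torus.partialDeriv n (fun y =>
          ∑ i, Torus.partialDeriv m (uc i) y * Torus.partialDeriv i (Torus.partialDeriv l (δu j)) y +
            Torus.partialDeriv m A y * Torus.partialDeriv j (Torus.partialDeriv l δρ) y +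
            Torus.partialDeriv m ζf y * Torus.partialDeriv j (Torus.partialDeriv l δθ) y) x - Cn -
      (-(∑ i, Torus.partialDeriv n (Torus.partialDeriv m (Torus.partialDeriv l (δu i))) x * du1 i x) -
          Torus.partialDeriv n (Torus.partialDeriv m (Torus.partialDeriv l δθ)) x * G1 x +
          Torus.partialDeriv n (Torus.partialDeriv m (Torus.partialDeriv l δρ)) x * G2 x -
        (∑ i, Torus.partialDeriv l (uc i) x *
            Torus.partialDeriv n (Torus.partialDeriv m (Torus.partialDeriv i (δu j))) x +
          Torus.partialDeriv l A x * Torus.partialDeriv n (Torus.partialDeriv m (Torus.partialDeriv j δρ)) x +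
          Torus.partialDeriv l ζf x * Torus.partialDeriv n (Torus.partialDeriv m (Torus.partialDeriv j δθ)) x) -
        (∑ i, Torus.partialDeriv m (uc i) x *
            Torus.partialDeriv n (Torus.partialDeriv i (Torus.partialDeriv l (δu j))) x +
          Torus.partialDeriv m A x * Torus.partialDeriv n (Torus.partialDeriv j (Torus.partialDeriv l δρ)) x +
          Torus.partialDeriv m ζf x * Torus.partialDeriv n (Torus.partialDeriv j (Torus.partialDeriv l δθ)) x) -
        Cn)| ≤ l3Rem M Z S₂ S₃ d₀ d₁ d₂ := by
  have nM : 0 ≤ M := hA.nonneg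
  have nZ : 0 ≤ Z := hE1.nonneg
  -- (1) expand the three derivative groups term by term
  rw [l3cv_lin3 (F := fun i y => δu i y * du1 i y) (fun i => l3cv_sm_mul (sδu i) (sdu1 i))
      (l3cv_sm_mul sδθ sG1) (l3cv_sm_mul sδρ sG2) sE1,
    l3cv_lin2 (F := fun i y => Torus.partialDeriv l (uc i) y * Torus.partialDeriv i (δu j) y)
      (fun i => l3cv_sm_mul ((suc i).partialDeriv l) ((sδu j).partialDeriv i))
      (l3cv_sm_mul (sA.partialDeriv l) (sδρ.partialDeriv j)) (l3cv_sm_mul (sζ.partialDeriv l) (sδθ.partialDeriv j)),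
    (l3cv_shapeB (F := fun i y => Torus.partialDeriv m (uc i) y * Torus.partialDeriv i (Torus.partialDeriv l (δu j)) y)
      (fun i => l3cv_sm_mul ((suc i).partialDeriv m) (((sδu j).partialDeriv l).partialDeriv i))
      (l3cv_sm_mul (sA.partialDeriv m) ((sδρ.partialDeriv l).partialDeriv j))
      (l3cv_sm_mul (sζ.partialDeriv m) ((sδθ.partialDeriv l).partialDeriv j)) n).2]
  -- (2) the atoms: forcing (top on the difference factor), commutators at `l` (order 2) and at `m` (order 1)
  have G₁ : ∀ {f g : T3 → ℝ}, Torus.IsSmooth f → Torus.IsSmooth g → |f x| ≤ d₀ →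
      (∀ a, |Torus.partialDeriv a f x| ≤ d₁) →
      (∀ a b, |Torus.partialDeriv b (Torus.partialDeriv a f) x| ≤ d₂) → Torus.HasDerivBoundsAt₃ g x M S₂ S₃ →
      |Torus.partialDeriv n (Torus.partialDeriv m (Torus.partialDeriv l (fun y => f y * g y))) x -
        Torus.partialDeriv n (Torus.partialDeriv m (Torus.partialDeriv l f)) x * g x| ≤
        3 * (d₂ * M) + 3 * (d₁ * (M * (1 + S₂))) + d₀ * (M * (1 + S₂ + S₃)) :=
    fun hf hg h0 h1 h2 hb => (abs_partialDeriv_mul_sub_top_le' hf hg h0 h1 h2 hb.zero hb.one hb.two hb.three).2.2 l m n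
  have G₂ : ∀ {f g : T3 → ℝ}, Torus.IsSmooth f → Torus.IsSmooth g → |f x| ≤ M →
      (∀ a, |Torus.partialDeriv a f x| ≤ M * (1 + S₂)) →
      (∀ a b, |Torus.partialDeriv b (Torus.partialDeriv a f) x| ≤ M * (1 + S₂ + S₃)) →
      |g x| ≤ d₁ → (∀ a, |Torus.partialDeriv a g x| ≤ d₂) →
      |Torus.partialDeriv n (Torus.partialDeriv m (fun y => f y * g y)) x -
        f x * Torus.partialDeriv n (Torus.partialDeriv m g) x| ≤
        2 * (M * (1 + S₂) * d₂) + M * (1 + S₂ + S₃) * d₁ :=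
    fun hf hg h0 h1 h2 k0 k1 => (abs_partialDeriv_mul_sub_top_le hf hg h0 h1 h2
      (fun a b c => Torus.abs_partialDeriv₃_le_dsize₃ _ x a b c) k0 k1
      (fun a b => Torus.abs_partialDeriv₂_le_dsize₂ _ x a b)).2.1 m n
  have G₃ : ∀ {f g : T3 → ℝ}, Torus.IsSmooth f → Torus.IsSmooth g → |f x| ≤ M →
      (∀ a, |Torus.partialDeriv a f x| ≤ M * (1 + S₂)) →
      (∀ a b, |Torus.partialDeriv b (Torus.partialDeriv a f) x| ≤ M * (1 + S₂ + S₃)) → |g x| ≤ d₂ →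
      |Torus.partialDeriv n (fun y => f y * g y) x - f x * Torus.partialDeriv n g x| ≤ M * (1 + S₂) * d₂ :=
    fun hf hg h0 h1 h2 k0 => (abs_partialDeriv_mul_sub_top_le hf hg h0 h1 h2
      (fun a b c => Torus.abs_partialDeriv₃_le_dsize₃ _ x a b c) k0 (fun a => Torus.abs_partialDeriv_le_dsize₁ _ x a)
      (fun a b => Torus.abs_partialDeriv₂_le_dsize₂ _ x a b)).1 n
  have a1 := fun i => abs_le.1 (G₁ (sδu i) (sdu1 i) (j0u i) (j1u i) (j2u i) (hdu1 i))
  have a2 := abs_le.1 (G₁ sδθ sG1 j0θ j1θ j2θ hG1)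
  have a3 := abs_le.1 (G₁ sδρ sG2 j0ρ j1ρ j2ρ hG2)
  have a4 := abs_le.1 (hE1.three l m n)
  have a5 := fun i => abs_le.1 (G₂ ((suc i).partialDeriv l) ((sδu j).partialDeriv i) (huc1 i l) (huc2 i l) (huc3 i l)
    (j1u j i) (j2u j i))
  have a6 := abs_le.1 (G₂ (sA.partialDeriv l) (sδρ.partialDeriv j) (hA.one l) (hA.two l) (hA.three l) (j1ρ j) (j2ρ j))
  have a7 := abs_le.1 (G₂ (sζ.partialDeriv l) (sδθ.partialDeriv j) (hζ.one l) (hζ.two l) (hζ.three l) (j1θ j)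
    (j2θ j))
  have a8 := fun i => abs_le.1 (G₃ ((suc i).partialDeriv m) (((sδu j).partialDeriv l).partialDeriv i) (huc1 i m)
    (huc2 i m) (huc3 i m) (j2u j l i))
  have a9 := abs_le.1 (G₃ (sA.partialDeriv m) ((sδρ.partialDeriv l).partialDeriv j) (hA.one m) (hA.two m)
    (hA.three m) (j2ρ l j))
  have a10 := abs_le.1 (G₃ (sζ.partialDeriv m) ((sδθ.partialDeriv l).partialDeriv j) (hζ.one m) (hζ.two m)
    (hζ.three m) (j2θ l j))
  -- (3) the envelope `5R₁ + Z(1+S₂+S₃) + 5R₂ + 5R₃ ≤ l3Rem`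
  have hR : 5 * (3 * (d₂ * M) + 3 * (d₁ * (M * (1 + S₂))) + d₀ * (M * (1 + S₂ + S₃))) + Z * (1 + S₂ + S₃) +
      5 * (2 * (M * (1 + S₂) * d₂) + M * (1 + S₂ + S₃) * d₁) + 5 * (M * (1 + S₂) * d₂) ≤
      l3Rem M Z S₂ S₃ d₀ d₁ d₂ := by
    unfold l3Rem
    have b1 : 0 ≤ M * d₂ := mul_nonneg nM hd₂
    have b2 : 0 ≤ M * d₁ := mul_nonneg nM hd₁
    have b3 : 0 ≤ M * d₀ := mul_nonneg nM hd₀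
    nlinarith [mul_nonneg b1 hS₂, mul_nonneg b2 hS₂, mul_nonneg b2 hS₃, mul_nonneg b3 hS₂, mul_nonneg b3 hS₃]
  -- (4) sum up
  simp only [Fin.sum_univ_three]
  rw [abs_le]
  constructor <;> linarith [(a1 0).1, (a1 0).2, (a1 1).1, (a1 1).2, (a1 2).1, (a1 2).2, a2.1, a2.2, a3.1, a3.2,
    a4.1, a4.2, (a5 0).1, (a5 0).2, (a5 1).1, (a5 1).2, (a5 2).1, (a5 2).2, a6.1, a6.2, a7.1, a7.2,
    (a8 0).1, (a8 0).2, (a8 1).1, (a8 1).2, (a8 2).1, (a8 2).2, a9.1, a9.2, a10.1, a10.2]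

/-! ### The velocity component -/

/-- **Crude bound, velocity component.** [folklore] -/
theorem level3_crude_velocity :
    ∀ {σ T : ℝ} {ρ θ ρ₁ θ₁ : ℝ → T3 → ℝ} {u u₁ : ℝ → T3 → V3} {ζ : ℝ → ℝ} {J : Set ℝ} {t : ℝ} {x : T3}
      {M Z S₂ S₃ d₀ d₁ d₂ : ℝ},
      IsHardSphereEulerSolution σ T ρ u θ → IsHardSphereEulerSolution 0 T ρ₁ u₁ θ₁ → IsOpen J →
      ContDiffOn ℝ (⊤ : ℕ∞) ζ J → (∀ s ∈ Ico 0 T, ∀ y, ρ s y ∈ J) →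
      (∀ s ∈ Ico 0 T, ∀ y, hsPressure σ (ρ s y) (θ s y) = ρ s y * θ s y * ζ (ρ s y)) → t ∈ Ico 0 T →
      0 ≤ M → 0 ≤ Z → 0 ≤ S₂ → 0 ≤ S₃ → 0 ≤ d₀ → 0 ≤ d₁ → 0 ≤ d₂ →
      Level3Coeff ζ ρ θ ρ₁ θ₁ u u₁ t x M Z S₂ S₃ → Level3Jets ρ θ ρ₁ θ₁ u u₁ t x d₀ d₁ d₂ →
      ∀ (l m n j : Fin 3),
        |l3Fu T ζ ρ θ ρ₁ θ₁ u u₁ t x l m n j - l3Topu ζ ρ θ ρ₁ θ₁ u u₁ t x l m n j| ≤ l3Rem M Z S₂ S₃ d₀ d₁ d₂ := by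
  intro σ T ρ θ ρ₁ θ₁ u u₁ ζ J t x M Z S₂ S₃ d₀ d₁ d₂ hE hE₁ hJ hζ hρJ hp ht _ _ hS₂ hS₃ hd₀ hd₁ hd₂ hC hJt
    l m n j
  obtain ⟨hu1, hu2, hu3, -, -, -, hA, hζb, -, -, -, hdu₁, -, hG1, hG2, -, hE1, -⟩ := hC
  obtain ⟨j0ρ, j0θ, j0u, j1ρ, j1θ, j1u, j2ρ, j2θ, j2u⟩ := hJt
  have hU : UniqueDiffOn ℝ (Ico (0 : ℝ) T) := uniqueDiffOn_Ico 0 T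
  have hρ0 : ∀ y, ρ t y ≠ 0 := fun y => (hE.density_pos t ht y).ne'
  have hρ₁0 : ∀ y, ρ₁ t y ≠ 0 := fun y => (hE₁.density_pos t ht y).ne'
  -- smooth slices and coefficient functions
  have sρ : Torus.IsSmooth (ρ t) := hE.smooth_density.isSmooth_slice ht
  have sθ : Torus.IsSmooth (θ t) := hE.smooth_temperature.isSmooth_slice ht
  have su : Torus.IsSmooth (u t) := hE.smooth_velocity.isSmooth_slice ht
  have sρ₁ : Torus.IsSmooth (ρ₁ t) := hE₁.smooth_density.isSmooth_slice ht
  have sθ₁ : Torus.IsSmooth (θ₁ t) := hE₁.smooth_temperature.isSmooth_slice ht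
  have su₁ : Torus.IsSmooth (u₁ t) := hE₁.smooth_velocity.isSmooth_slice ht
  have sU : Torus.IsSmooth (fun z => u t z - u₁ t z) := su.sub su₁
  have suc : ∀ i, Torus.IsSmooth (fun y => u t y i) := fun i => su.apply i
  have sδu : ∀ i, Torus.IsSmooth (fun y => u t y i - u₁ t y i) := fun i => l3cv_sm_sub (su.apply i) (su₁.apply i)
  have sδρ : Torus.IsSmooth (fun y => ρ t y - ρ₁ t y) := l3cv_sm_sub sρ sρ₁
  have sδθ : Torus.IsSmooth (fun y => θ t y - θ₁ t y) := l3cv_sm_sub sθ sθ₁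
  have sζ : Torus.IsSmooth (fun y => ζ (ρ t y)) := Torus.IsSmooth.comp_of_contDiffOn hζ sρ (hρJ t ht)
  have sγ : Torus.IsSmooth (fun y => ζ (ρ t y) + ρ t y * deriv ζ (ρ t y)) :=
    l3cv_sm_add sζ (l3cv_sm_mul sρ (Torus.IsSmooth.comp_of_contDiffOn (hζ.deriv_of_isOpen hJ le_rfl) sρ (hρJ t ht)))
  have sA : Torus.IsSmooth (fun y => θ t y * (ζ (ρ t y) + ρ t y * deriv ζ (ρ t y)) / ρ t y) :=
    l3cv_sm_div (l3cv_sm_mul sθ sγ) sρ hρ0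
  have sdu1 : ∀ i, Torus.IsSmooth (fun y => Torus.partialDeriv i (fun z => u₁ t z j) y) :=
    fun i => (su₁.apply j).partialDeriv i
  have sG1 : Torus.IsSmooth
      (fun y => (ζ (ρ t y) + ρ t y * deriv ζ (ρ t y)) / ρ t y * Torus.partialDeriv j (ρ₁ t) y) :=
    l3cv_sm_mul (l3cv_sm_div sγ sρ hρ0) (sρ₁.partialDeriv j)
  have sG2 : Torus.IsSmooth (fun y => θ₁ t y / (ρ t y * ρ₁ t y) * Torus.partialDeriv j (ρ₁ t) y) :=
    l3cv_sm_mul (l3cv_sm_div sθ₁ (l3cv_sm_mul sρ sρ₁) fun y => mul_ne_zero (hρ0 y) (hρ₁0 y))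
      (sρ₁.partialDeriv j)
  have sE1 : Torus.IsSmooth (fun y => θ₁ t y * (ζ (ρ t y) + ρ t y * deriv ζ (ρ t y) - 1) / ρ t y *
      Torus.partialDeriv j (ρ₁ t) y + (ζ (ρ t y) - 1) * Torus.partialDeriv j (θ₁ t) y) :=
    l3cv_sm_add (l3cv_sm_mul (l3cv_sm_div (l3cv_sm_mul sθ₁ (l3cv_sm_sub sγ (Torus.isSmooth_const _))) sρ hρ0)
      (sρ₁.partialDeriv j)) (l3cv_sm_mul (l3cv_sm_sub sζ (Torus.isSmooth_const _)) (sθ₁.partialDeriv j))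
  -- coordinates of the differentiated velocity difference
  have hc1f : (fun y => Torus.partialDeriv l (fun z => u t z - u₁ t z) y j) =
      Torus.partialDeriv l (fun z => u t z j - u₁ t z j) :=
    funext fun y => (Torus.partialDeriv_apply_coord (sU.isContDiff (by simp)) l y j).symm
  have hc2f : (fun y => Torus.partialDeriv m (Torus.partialDeriv l (fun z => u t z - u₁ t z)) y j) =
      Torus.partialDeriv m (Torus.partialDeriv l (fun z => u t z j - u₁ t z j)) := by
    funext y
    rw [← Torus.partialDeriv_apply_coord ((sU.partialDeriv l).isContDiff (by simp)) m y j, hc1f]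
  -- (1) the level-3 identity: one commutator step on the level-2 forcing (ideal-gas reference `ζ₂ ≡ 1`)
  have hJc := hsEuler_frozen_commutator_velocity
    (α := fun s => Torus.partialDeriv m (Torus.partialDeriv l (fun y => ρ s y - ρ₁ s y)))
    (w := fun s => Torus.partialDeriv m (Torus.partialDeriv l (fun y => u s y - u₁ s y)))
    (β := fun s => Torus.partialDeriv m (Torus.partialDeriv l (fun y => θ s y - θ₁ s y))) hE hJ hζ hρJ
    (((hE.smooth_density.sub hE₁.smooth_density).partialDeriv hU l).partialDeriv hU m)
    (((hE.smooth_velocity.sub hE₁.smooth_velocity).partialDeriv hU l).partialDeriv hU m)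
    (((hE.smooth_temperature.sub hE₁.smooth_temperature).partialDeriv hU l).partialDeriv hU m) ht x n j
  have hp₁ : ∀ s ∈ Ico 0 T, ∀ y, hsPressure 0 (ρ₁ s y) (θ₁ s y) =
      ρ₁ s y * θ₁ s y * (fun _ : ℝ => (1 : ℝ)) (ρ₁ s y) := by
    intro s _ y; simp [hsPressure, hsCompressibility]
  have h2 := fun y => hsEuler_level2_forcing_velocity hE hE₁ hJ hζ hρJ hp isOpen_univ contDiffOn_const
    (fun _ _ _ => mem_univ _) hp₁ ht y l m j
  -- the pressure-coefficient split `θγ/ρ - θ₁/ρ₁ = δθ·γ/ρ + θ₁(γ - 1)/ρ - δρ·θ₁/(ρρ₁)` (pointwise algebra)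
  have hfeq : ∀ y, -(∑ i, (u t y i - u₁ t y i) * Torus.partialDeriv i (fun z => u₁ t z j) y) -
        (θ t y * (ζ (ρ t y) + ρ t y * deriv ζ (ρ t y)) / ρ t y -
          θ₁ t y * (1 + ρ₁ t y * deriv (fun _ : ℝ => (1 : ℝ)) (ρ₁ t y)) / ρ₁ t y) *
          Torus.partialDeriv j (ρ₁ t) y -
        (ζ (ρ t y) - 1) * Torus.partialDeriv j (θ₁ t) y =
      -(∑ i, (u t y i - u₁ t y i) * Torus.partialDeriv i (fun z => u₁ t z j) y) -
        (θ t y - θ₁ t y) * ((ζ (ρ t y) + ρ t y * deriv ζ (ρ t y)) / ρ t y * Torus.partialDeriv j (ρ₁ t) y) +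
        (ρ t y - ρ₁ t y) * (θ₁ t y / (ρ t y * ρ₁ t y) * Torus.partialDeriv j (ρ₁ t) y) -
        (θ₁ t y * (ζ (ρ t y) + ρ t y * deriv ζ (ρ t y) - 1) / ρ t y * Torus.partialDeriv j (ρ₁ t) y +
          (ζ (ρ t y) - 1) * Torus.partialDeriv j (θ₁ t) y) := by
    intro y
    have h1 := hρ0 y
    have h2 := hρ₁0 y
    simp only [deriv_const, mul_zero, add_zero, mul_one]
    field_simp
    ring
  unfold l3Fu
  rw [hJc, funext h2, funext hfeq, hc1f, hc2f,
    l3cv_expand ((l3cv_shapeA (fun i => l3cv_sm_mul (sδu i) (sdu1 i)) (l3cv_sm_mul sδθ sG1)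
      (l3cv_sm_mul sδρ sG2) sE1 l).1)
    ((l3cv_shapeB (F := fun i y => Torus.partialDeriv l (fun y => u t y i) y *
        Torus.partialDeriv i (fun y => (u t y - u₁ t y) j) y)
      (fun i => l3cv_sm_mul ((suc i).partialDeriv l) ((sU.apply j).partialDeriv i))
      (l3cv_sm_mul (sA.partialDeriv l) (sδρ.partialDeriv j))
      (l3cv_sm_mul (sζ.partialDeriv l) (sδθ.partialDeriv j)) l).1)
    ((l3cv_shapeB (F := fun i y => Torus.partialDeriv m (fun y => u t y i) y *
        Torus.partialDeriv i (Torus.partialDeriv l (fun z => u t z j - u₁ t z j)) y)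
      (fun i => l3cv_sm_mul ((suc i).partialDeriv m) (((sδu j).partialDeriv l).partialDeriv i))
      (l3cv_sm_mul (sA.partialDeriv m) ((sδρ.partialDeriv l).partialDeriv j))
      (l3cv_sm_mul (sζ.partialDeriv m) ((sδθ.partialDeriv l).partialDeriv j)) m).1) l m n x]
  -- (2) the crude bound
  unfold l3Topu
  exact l3cv_core hS₂ hS₃ hd₀ hd₁ hd₂ sδu suc sdu1 sδρ sδθ sA sζ sG1 sG2 sE1 hu1 hu2 hu3 hA hζb
    (fun i => hdu₁ i j) (hG1 j) (hG2 j) (hE1 j) j0u j1u j2u j0ρ j1ρ j2ρ j0θ j1θ j2θ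

end Summit.AtomisticToContinuum.HydrodynamicLimit.Theorems

end
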